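import Mathlib
import Literature.Computability.AlgebraicComplexity.NestFreeMatchingPoly
import Summits.ValiantsHypothesis.ValiantsHypothesis.Theorems.FifoMatchingNNDivisionHardAdjacentArcFace
import Summits.ValiantsHypothesis.ValiantsHypothesis.Theorems.FifoMatchingNNDivisionHardUniversalTransport
import Summits.ValiantsHypothesis.ValiantsHypothesis.Theorems.FifoMatchingNNDivisionHardLinearTransportExplicit
import Summits.ValiantsHypothesis.ValiantsHypothesis.Theorems.FifoMatchingNNMonomialCofactorHard
import Summits.ValiantsHypothesis.ValiantsHypothesis.Theorems.DivisionGapPerCofactorDegreeReductionStubMonomialStripping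
import HarnessLib

/-!
# Route FifoMatching — crux `NNDivisionHard` (stmt-ValiantsHypothesis-21181): LEXICOGRAPHIC transport — a second tie-break
# in any direction vanishing on the block, and the unique-maximiser rung for ARBITRARY outside arcs

The linear transport engine (`LinearTransport.linear_transport_monomial`) reads the `w`-top component of the cofactor.
Here a SECOND direction `w'` vanishing on the block variables is applied after `w`: since `top_{w'}(ι(Q)) = ι(Q)`
(`topComponent_rename_eq_self`), the split `top_w P = ι(Q) · S` passes to `top_{w'}(top_w P) = ι(Q) · top_{w'} S`, and the
engine applies verbatim to the pair `(top_w P, top_w h)` (top components are free):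

* `topComponent_rename_eq_self` — a direction vanishing on the range of `ι` does not touch `ι(Q)`;
* ★ `lex_transport_monomial` — **if all monomials of `top_{w'}(top_w h)` restrict to the same `μ` on the block, then
  `L₊(Q · x^μ) ≤ L₊(P · h) + 2`;**
* ★★ `complexity_nn_mul_monomial_le_of_lexUniqueMax`, `complexity_nn_le_of_lexUniqueMax` — instance `P = NN_{b+c}`,
  `w = 𝟙_L` (split face), `w' = 𝟙_e` for ANY arc variable `e` not internal to the prefix block `L = [0, 2b)`: **if among
  the `𝟙_L`-heaviest monomials of `h` ONE monomial `m₀` has strictly larger `x_e`-degree than all others, then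
  `L₊(NN_b · x^{m₀|L}) ≤ L₊(NN_{b+c} · h) + 2` and `L₊(NN_b) ≤ 16((2b+1)(L₊(NN_{b+c} · h)+3))²`.**  For cofactors of
  constant `L`-degree (e.g. block products) this is a unique-maximiser rung for EVERY arc outside a polylog prefix — the
  adjacent-arc rung of `…NNDivisionHardAdjacentArcFace` needed `e = (2b, 2b+1)`.

HONEST FRAMING: a rung; the residual of stmt-21181 stays OPEN (Hrubeš–Yehudayoff 2021 §6 Problem 2); nothing here bears on
`NNNotVP` or on VP ≠ VNP (NOT proved).
References: Bürgisser 2000 Rem. 2.7 [Burgisser2000]; Jukna–Seiwert–Sergeev 2022 Thm 1 [JuknaSeiwertSergeev2022].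
-/

noncomputable section

-- Sub = Summit single-conjunct layout: the duplicated namespace component is mandated by the tree.
set_option linter.dupNamespace false
set_option autoImplicit false

namespace Summit.ValiantsHypothesis.ValiantsHypothesis.Theorems.FifoMatching.NNDivisionHard.LexTransport

open Finset MvPolynomial Literature.Computability.AlgebraicComplexity
open Summit.ValiantsHypothesis.ValiantsHypothesis.Theorems.ZeroOneTransfer.Negative
  (topComponent topComponent_mul complexity_topComponent_le topComponent_ne_zero coeff_topComponent
    support_topComponent_subset topComponent_eq_self_of_isWeightedHomogeneous)
open Summit.ValiantsHypothesis.ValiantsHypothesis.Theorems.FifoMatching.NNDivisionHard.StackPowersQueue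
  (blockEmb blockEmb_injective)
open Summit.ValiantsHypothesis.ValiantsHypothesis.Theorems.FifoMatching.NNDivisionHard.UniversalTransport
  (indWeight weight_indWeight)
open Summit.ValiantsHypothesis.ValiantsHypothesis.Theorems.FifoMatching.NNDivisionHard.LinearTransport
  (linear_transport_monomial)
open Summit.ValiantsHypothesis.ValiantsHypothesis.Theorems.FifoMatching.NNDivisionHard.SplitFace
  (lWeight blockEmbR two_mul_le blockEmbR_injective topComponent_lWeight support_rename_blockEmbR_outside)
open Summit.ValiantsHypothesis.ValiantsHypothesis.Theorems.FifoMatching.NNDivisionHard.AdjacentArcFace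
  (support_topComponent_subset_of_unique_max)
open Summit.ValiantsHypothesis.ValiantsHypothesis.Theorems.DivisionGap.PerCofactorDegreeReduction.MonomialStripping
  (complexity_le_of_monomial_mul)
open scoped NNReal BigOperators

/-! ### §1 A second direction vanishing on the block -/

/-- A direction vanishing on the range of `ι` does not touch `ι(Q)`. [folklore] -/
theorem topComponent_rename_eq_self {σ τ : Type*} {ι : τ → σ} (hι : Function.Injective ι) (w' : σ → ℕ)
    (hw' : ∀ t, w' (ι t) = 0) (Q : MvPolynomial τ ℝ≥0) : topComponent w' (rename ι Q) = rename ι Q := by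
  classical
  refine topComponent_eq_self_of_isWeightedHomogeneous w' (n := 0) fun m hm => ?_
  have hm' : m ∈ (rename ι Q).support := mem_support_iff.2 hm
  rw [support_rename_of_injective hι, Finset.mem_image] at hm'
  obtain ⟨d, -, rfl⟩ := hm'
  rw [Finsupp.weight_apply,
    Finsupp.sum_mapDomain_index (h := fun i c => c • w' i) (fun _ => zero_smul ℕ _) (fun _ _ _ => add_smul _ _ _)]
  exact Finset.sum_eq_zero fun t _ => by simp only [hw' t, smul_zero]

/-- ★ **LEXICOGRAPHIC SHADOW-GENERIC TRANSPORT.**  In the situation of `linear_transport` (`top_w P = ι(Q) · S`), let `w'` be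
a second direction vanishing on the range of `ι`.  If all monomials of `top_{w'}(top_w h)` have the same restriction `μ` to
the block, then `L₊(Q · x^μ) ≤ L₊(P · h) + 2`. [cite: Burgisser2000, Rem. 2.7] -/
theorem lex_transport_monomial {σ τ : Type*} {ι : τ → σ} (hι : Function.Injective ι) (w w' : σ → ℕ)
    (hw' : ∀ t, w' (ι t) = 0) {P S : MvPolynomial σ ℝ≥0} {Q : MvPolynomial τ ℝ≥0}
    (hface : topComponent w P = rename ι Q * S) (hS0 : S ≠ 0)
    (hS : ∀ m ∈ S.support, ∀ e ∈ m.support, e ∉ Set.range ι)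
    {h : MvPolynomial σ ℝ≥0} (hh : h ≠ 0) (μ : τ →₀ ℕ)
    (hgen : ∀ m ∈ (topComponent w' (topComponent w h)).support, ∀ t : τ, m (ι t) = μ t) :
    complexity (Q * monomial μ 1) ≤ complexity (P * h) + 2 := by
  have hface' : topComponent w' (topComponent w P) = rename ι Q * topComponent w' S := by
    rw [hface, topComponent_mul, topComponent_rename_eq_self hι w' hw']
  have hS' : ∀ m ∈ (topComponent w' S).support, ∀ e ∈ m.support, e ∉ Set.range ι :=
    fun m hm => hS m (support_topComponent_subset w' S hm)
  have H := linear_transport_monomial hι w' hface' (topComponent_ne_zero w' hS0) hS'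
    (topComponent_ne_zero w hh) μ hgen
  calc complexity (Q * monomial μ 1) ≤ complexity (topComponent w P * topComponent w h) + 2 := H
    _ = complexity (topComponent w (P * h)) + 2 := by rw [topComponent_mul]
    _ ≤ complexity (P * h) + 2 := by gcongr; exact complexity_topComponent_le w _

/-! ### §2 The split face with a second tie-break at an arbitrary outside arc -/

variable {b c : ℕ}

/-- ★★ **THE LEXICOGRAPHIC UNIQUE-MAXIMISER RUNG** (additive form).  Let `e` be an arc variable NOT internal to the prefix
block `L = [0, 2b)`.  If among the `𝟙_L`-heaviest monomials of `h` ONE monomial `m₀` has strictly larger `x_e`-degree than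
all others, then `L₊(NN_b · x^{m₀|L}) ≤ L₊(NN_{b+c} · h) + 2`. [cite: Burgisser2000, Rem. 2.7] -/
theorem complexity_nn_mul_monomial_le_of_lexUniqueMax
    {h : MvPolynomial (Fin (2 * (b + c)) × Fin (2 * (b + c))) ℝ≥0}
    (e : Fin (2 * (b + c)) × Fin (2 * (b + c))) (he : ¬ ((e.1 : ℕ) < 2 * b ∧ (e.2 : ℕ) < 2 * b))
    {m₀ : (Fin (2 * (b + c)) × Fin (2 * (b + c))) →₀ ℕ} (hm₀ : m₀ ∈ (topComponent (lWeight b c) h).support)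
    (huniq : ∀ m ∈ (topComponent (lWeight b c) h).support, m ≠ m₀ → m e < m₀ e) :
    complexity (nestFreeMatchingPoly b ℝ≥0 *
        monomial (m₀.comapDomain (blockEmb (two_mul_le b c)) (blockEmb_injective _).injOn) 1) ≤
      complexity (nestFreeMatchingPoly (b + c) ℝ≥0 * h) + 2 := by
  classical
  have hh : h ≠ 0 := fun h0 => by
    have := support_topComponent_subset (lWeight b c) h hm₀
    rw [h0, support_zero] at this
    exact Finset.notMem_empty _ this
  have hw' : ∀ t, indWeight e (blockEmb (two_mul_le b c) t) = 0 := by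
    intro t
    unfold indWeight
    rw [if_neg]
    rintro rfl
    exact he ⟨t.1.isLt, t.2.isLt⟩
  refine lex_transport_monomial (blockEmb_injective (two_mul_le b c)) (lWeight b c) (indWeight e) hw'
    topComponent_lWeight
    (fun h0 => MonomialCofactor.nn_ne_zero c (rename_injective _ blockEmbR_injective (by rw [h0, map_zero])))
    (support_rename_blockEmbR_outside _) hh _ fun m hm t => ?_
  rw [support_topComponent_subset_of_unique_max e hm₀ huniq m hm, Finsupp.comapDomain_apply]

/-- ★★ **THE LEXICOGRAPHIC UNIQUE-MAXIMISER RUNG**, after Jukna–Seiwert–Sergeev stripping: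
`L₊(NN_b) ≤ 16((2b+1)(L₊(NN_{b+c} · h)+3))²`. [cite: JuknaSeiwertSergeev2022, Thm 1] -/
theorem complexity_nn_le_of_lexUniqueMax
    {h : MvPolynomial (Fin (2 * (b + c)) × Fin (2 * (b + c))) ℝ≥0}
    (e : Fin (2 * (b + c)) × Fin (2 * (b + c))) (he : ¬ ((e.1 : ℕ) < 2 * b ∧ (e.2 : ℕ) < 2 * b))
    {m₀ : (Fin (2 * (b + c)) × Fin (2 * (b + c))) →₀ ℕ} (hm₀ : m₀ ∈ (topComponent (lWeight b c) h).support)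
    (huniq : ∀ m ∈ (topComponent (lWeight b c) h).support, m ≠ m₀ → m e < m₀ e) :
    complexity (nestFreeMatchingPoly b ℝ≥0) ≤
      16 * ((2 * b + 1) * (complexity (nestFreeMatchingPoly (b + c) ℝ≥0 * h) + 3)) ^ 2 := by
  have H := complexity_nn_mul_monomial_le_of_lexUniqueMax e he hm₀ huniq
  rw [mul_comm (nestFreeMatchingPoly b ℝ≥0)] at H
  have H' : complexity (monomial
      (m₀.comapDomain (blockEmb (two_mul_le b c)) (blockEmb_injective _).injOn) (1 : ℝ≥0) *
        nestFreeMatchingPoly b ℝ≥0) + 1 ≤ complexity (nestFreeMatchingPoly (b + c) ℝ≥0 * h) + 3 := by omega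
  calc complexity (nestFreeMatchingPoly b ℝ≥0)
      ≤ 16 * ((2 * b + 1) * (complexity (monomial
          (m₀.comapDomain (blockEmb (two_mul_le b c)) (blockEmb_injective _).injOn) (1 : ℝ≥0) *
            nestFreeMatchingPoly b ℝ≥0) + 1)) ^ 2 := complexity_le_of_monomial_mul (2 * b) _ _
    _ ≤ 16 * ((2 * b + 1) * (complexity (nestFreeMatchingPoly (b + c) ℝ≥0 * h) + 3)) ^ 2 := by gcongr

/-- ★★ **`b ≤ n` form**: for any arc variable `e` of `[0, 2n)` not internal to the prefix block `[0, 2b)`, a unique maximiser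
of the `x_e`-degree among the `𝟙_{[0,2b)}`-heaviest monomials of `h` gives `L₊(NN_b) ≤ 16((2b+1)(L₊(NN_n · h)+3))²`.
[cite: JuknaSeiwertSergeev2022, Thm 1] -/
theorem complexity_nn_le_of_lexUniqueMax' {n b : ℕ} (hb : b ≤ n)
    {h : MvPolynomial (Fin (2 * n) × Fin (2 * n)) ℝ≥0} (e : Fin (2 * n) × Fin (2 * n))
    (he : ¬ ((e.1 : ℕ) < 2 * b ∧ (e.2 : ℕ) < 2 * b)) {m₀ : (Fin (2 * n) × Fin (2 * n)) →₀ ℕ}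
    (hm₀ : m₀ ∈ (topComponent (fun x : Fin (2 * n) × Fin (2 * n) =>
        if (x.1 : ℕ) < 2 * b ∧ (x.2 : ℕ) < 2 * b then 1 else 0) h).support)
    (huniq : ∀ m ∈ (topComponent (fun x : Fin (2 * n) × Fin (2 * n) =>
        if (x.1 : ℕ) < 2 * b ∧ (x.2 : ℕ) < 2 * b then 1 else 0) h).support, m ≠ m₀ → m e < m₀ e) :
    complexity (nestFreeMatchingPoly b ℝ≥0) ≤
      16 * ((2 * b + 1) * (complexity (nestFreeMatchingPoly n ℝ≥0 * h) + 3)) ^ 2 := by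
  obtain ⟨c, rfl⟩ := Nat.exists_eq_add_of_le hb
  exact complexity_nn_le_of_lexUniqueMax e he hm₀ huniq

end Summit.ValiantsHypothesis.ValiantsHypothesis.Theorems.FifoMatching.NNDivisionHard.LexTransport

end
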